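import Literature.Analysis.SpecialFunctions.LogCothCosineTransform
import Literature.MathematicalPhysics.QuantumLattice.DuhamelTwoPoint
import HarnessLib

/-!
# The quantum-belief-propagation weight `f_β` (Hastings; Capel–Moscolari–Teufel–Wessel eq. (10.1)–(10.2))

The generator of quantum belief propagation (QBP) for the Gibbs state of `H(s) = H + sV` is the
weighted Heisenberg average `Φ_β^{H(s)}(V) = ∫ f_β(t) e^{-itH(s)} V e^{itH(s)} dt` whose weight
`f_β ∈ L¹(ℝ)` is determined by its Fourier transform `f̂_β(ω) = tanh(βω/2)/(βω/2)` — the condition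
that makes `d/ds e^{-βH(s)} = -(β/2){e^{-βH(s)}, Φ_β^{H(s)}(V)}` hold (Capel–Moscolari–Teufel–Wessel,
Commun. Math. Phys. 406 (2025) 43 = arXiv:2310.09182, Prop. 6 and §10.1.1; Hastings, Phys. Rev. B 76
(2007) 201102).  CMTW eq. (10.1)–(10.2) record, citing Anshu–Arunachalam–Kuwahara–Soleimanifar
(2021) and Ejima–Ogata (2019):

  `f_β(t) = (1/2π) ∫ e^{iωt} f̂_β(ω) dω = (2/(βπ)) log((e^{π|t|/β} + 1)/(e^{π|t|/β} - 1))`,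
  `‖f_β‖_{L¹} = 1`, and `f_β(t) ≤ (4/(βπ)) · 1/(e^{π|t|/β} - 1)` (exponential decay).

This file DEFINES `qbpWeight β t` by the printed closed form (10.1) and PROVES, for `β > 0`:

* `qbpWeight_nonneg`, `qbpWeight_neg` (even), `qbpWeight_le` (the tail bound (10.2));
* `integrable_qbpWeight` (`f_β ∈ L¹`), `integral_qbpWeight` (`∫ f_β = 1`),
  `integral_abs_qbpWeight` (`‖f_β‖₁ = 1`);
* `integral_qbpWeight_mul_cos` — `∫ f_β(t) cos(ωt) dt = 2 tanh(βω/2)/(βω)` (`ω ≠ 0`), i.e.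
  `f̂_β(ω) = tanh(βω/2)/(βω/2)`; `integral_qbpWeight_mul_sin` (`= 0`, oddness) and the complex form
  `integral_cexp_mul_qbpWeight`;
* `qbpWeight_kernel_identity` — the KERNEL IDENTITY
  `f̂_β(y - x) · (e^{-βx} + e^{-βy}) = 2 K_β(x, y)` with the tree's logarithmic-mean (Duhamel) kernel
  `Matrix.duhamelKernel β x y = ∫₀¹ e^{-β(sy + (1-s)x)} ds` — literally the hypothesis `hfK` of
  `Summits/Ventures/CertifiedManyBodySolver/Theorems/TcThermcert1QbpGibbsDerivative.lean`
  (`exists_qbp_conjugation`, CMTW Prop. 6 (a) for a generic weight), so that proposition now holds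
  for THE weight `f_β` (`exists_qbp_conjugation … (integrable_qbpWeight hβ) (qbpWeight_kernel_identity hβ)`).

* `hasSum_qbpWeight` / `qbpWeight_eq_tsum` — the Matsubara-series form
  `f_β(t) = Σ_{m ≥ 0} (4/(β(2m+1)π)) e^{-(2m+1)π|t|/β}` (all `t`; at `t = 0` both sides are junk `0`),
  which is the presentation used as hypothesis `hf` by
  `Summits/Ventures/CertifiedManyBodySolver/Theorems/TcThermcert1QbpWeight.lean` (part 4 of the same
  port): `f := qbpWeight β` discharges that `hf`, so the two developments are interchangeable.

The analysis is in `Literature/Analysis/SpecialFunctions/LogCothCosineTransform.lean`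
(`∫₀^∞ log coth(x) cos(bx) dx = (π/(2b)) tanh(πb/4)`, total mass `π²/8`, integrability); here we
only rescale `x = π|t|/(2β)` and do the bookkeeping.  One definition (`qbpWeight`), theorems
otherwise; no named fact.

## References

* Á. Capel, M. Moscolari, S. Teufel, T. Wessel, Commun. Math. Phys. 406 (2025) 43 =
  arXiv:2310.09182, §10.1.1 eq. (10.1)–(10.2) and Prop. 6. [CapelEtAl2023]
* A. Anshu, S. Arunachalam, T. Kuwahara, M. Soleimanifar, Nature Physics 17 (2021) 931
  (Supplementary Information: the inverse Fourier transform of `tanh(βω/2)/(βω/2)`). [AnshuEtAl2021]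
* M. B. Hastings, Phys. Rev. B 76 (2007) 201102(R) (quantum belief propagation).
-/

noncomputable section

open Real MeasureTheory Set Filter Complex
open Literature.Analysis.SpecialFunctions

namespace Literature.MathematicalPhysics.QuantumLattice

/-- **The QBP weight** `f_β(t) = (2/(βπ)) log((e^{π|t|/β} + 1)/(e^{π|t|/β} - 1))`, Capel–Moscolari–
Teufel–Wessel eq. (10.1) (the inverse Fourier transform of `tanh(βω/2)/(βω/2)`).  Junk value `0` at
`t = 0` (Lean's `x/0 = 0`, `log 0 = 0`); meaningful for `β > 0`. [cite: CapelEtAl2023, §10.1.1 eq. (10.1)] -/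
def qbpWeight (β t : ℝ) : ℝ :=
  2 / (β * π) * Real.log ((Real.exp (π * |t| / β) + 1) / (Real.exp (π * |t| / β) - 1))

/-! ## §1 Reduction to the `log coth` kernel, sign, symmetry, tail -/

/-- `(e^u + 1)/(e^u - 1) = (1 + e^{-u})/(1 - e^{-u})` (as real division, also at `u = 0`). [folklore] -/
private theorem exp_add_one_div_exp_sub_one (u : ℝ) :
    (Real.exp u + 1) / (Real.exp u - 1) = (1 + Real.exp (-u)) / (1 - Real.exp (-u)) := by
  have hE : Real.exp u ≠ 0 := (Real.exp_pos u).ne'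
  have h1 : Real.exp u + 1 = Real.exp u * (1 + Real.exp (-u)) := by
    rw [mul_add, mul_one, ← Real.exp_add, add_neg_cancel, Real.exp_zero]
  have h2 : Real.exp u - 1 = Real.exp u * (1 - Real.exp (-u)) := by
    rw [mul_sub, mul_one, ← Real.exp_add, add_neg_cancel, Real.exp_zero]
  rw [h1, h2, mul_div_mul_left _ _ hE]

/-- **Reduction**: `f_β(t) = (2/(βπ)) · log coth((π/(2β))|t|)` with `log coth x` written as
`log((1 + e^{-2x})/(1 - e^{-2x}))` (the kernel of `LogCothCosineTransform`). [cite: CapelEtAl2023, §10.1.1 eq. (10.1)] -/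
theorem qbpWeight_eq_log_coth (β t : ℝ) :
    qbpWeight β t = 2 / (β * π) *
      Real.log ((1 + Real.exp (-(2 * (π / (2 * β) * |t|)))) /
        (1 - Real.exp (-(2 * (π / (2 * β) * |t|))))) := by
  rw [qbpWeight, exp_add_one_div_exp_sub_one]
  rcases eq_or_ne β 0 with rfl | hβ
  · simp
  · have hu : -(2 * (π / (2 * β) * |t|)) = -(π * |t| / β) := by
      field_simp
    rw [hu]

/-- `f_β` is even. [cite: CapelEtAl2023, §10.1.1 eq. (10.1)] -/
theorem qbpWeight_neg (β t : ℝ) : qbpWeight β (-t) = qbpWeight β t := by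
  simp [qbpWeight, abs_neg]

/-- **`f_β ≥ 0`** (`β > 0`). [cite: CapelEtAl2023, §10.1.1 eq. (10.1)–(10.2)] -/
theorem qbpWeight_nonneg {β : ℝ} (hβ : 0 < β) (t : ℝ) : 0 ≤ qbpWeight β t := by
  rw [qbpWeight_eq_log_coth]
  rcases eq_or_ne t 0 with rfl | ht
  · simp
  · have hx : 0 < π / (2 * β) * |t| := by positivity
    exact mul_nonneg (by positivity) (log_coth_nonneg hx)

/-- **The tail bound (10.2)**: `f_β(t) ≤ (4/(βπ)) · 1/(e^{π|t|/β} - 1)` for `t ≠ 0` (`log(1+u) ≤ u`).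
[cite: CapelEtAl2023, §10.1.1 eq. (10.2)] -/
theorem qbpWeight_le {β : ℝ} (hβ : 0 < β) {t : ℝ} (ht : t ≠ 0) :
    qbpWeight β t ≤ 4 / (β * π) * (1 / (Real.exp (π * |t| / β) - 1)) := by
  rw [qbpWeight_eq_log_coth]
  have hx : 0 < π / (2 * β) * |t| := by positivity
  have h := log_coth_le hx
  have hu : 2 * (π / (2 * β) * |t|) = π * |t| / β := by field_simp
  rw [hu] at h ⊢
  -- `2e^{-u}/(1 - e^{-u}) = 2/(e^u - 1)`
  have hE : Real.exp (π * |t| / β) ≠ 0 := (Real.exp_pos _).ne'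
  have hq : 2 * Real.exp (-(π * |t| / β)) / (1 - Real.exp (-(π * |t| / β))) =
      2 / (Real.exp (π * |t| / β) - 1) := by
    rw [Real.exp_neg]
    field_simp
  rw [hq] at h
  calc 2 / (β * π) * Real.log ((1 + Real.exp (-(π * |t| / β))) / (1 - Real.exp (-(π * |t| / β))))
      ≤ 2 / (β * π) * (2 / (Real.exp (π * |t| / β) - 1)) := by gcongr
    _ = 4 / (β * π) * (1 / (Real.exp (π * |t| / β) - 1)) := by ring

/-! ## §2 Integrability and the Fourier (cosine) transform -/

/-- From integrability on `(0, ∞)` to integrability of `t ↦ h |t|` on `ℝ`. [folklore] -/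
private theorem integrable_comp_abs_of_integrableOn {h : ℝ → ℝ} (hh : IntegrableOn h (Ioi 0)) :
    Integrable (fun t => h |t|) := by
  have hIoi : IntegrableOn (fun t => h |t|) (Ioi 0) :=
    hh.congr_fun (fun t ht => by rw [abs_of_pos (show (0 : ℝ) < t from ht)]) measurableSet_Ioi
  have hIci : IntegrableOn (fun t => h |t|) (Ici 0) := (integrableOn_Ici_iff_integrableOn_Ioi).mpr hIoi
  have hIic : IntegrableOn (fun t => h |t|) (Iic 0) := by
    rw [← Measure.map_neg_eq_self (volume : Measure ℝ)]
    let m : MeasurableEmbedding fun x : ℝ => -x := (Homeomorph.neg ℝ).measurableEmbedding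
    rw [m.integrableOn_map_iff]
    simp_rw [Function.comp_def, abs_neg, neg_preimage, neg_Iic, neg_zero]
    exact hIci
  have h := hIic.union hIoi
  rw [Iic_union_Ioi] at h
  exact integrableOn_univ.mp h

/-- The rescaled kernel `t ↦ log coth(a t) · cos(ω t)` is integrable on `(0, ∞)` and its integral is
`a⁻¹ ∫₀^∞ log coth(x) cos((ω/a) x) dx` (`a > 0`). [folklore] -/
private theorem integral_log_coth_comp_mul_mul_cos {a : ℝ} (ha : 0 < a) (ω : ℝ) :
    IntegrableOn (fun t => Real.log ((1 + Real.exp (-(2 * (a * t)))) / (1 - Real.exp (-(2 * (a * t))))) *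
        Real.cos (ω * t)) (Ioi 0) ∧
      ∫ t in Ioi (0 : ℝ), Real.log ((1 + Real.exp (-(2 * (a * t)))) / (1 - Real.exp (-(2 * (a * t))))) *
        Real.cos (ω * t) = a⁻¹ * ∫ x in Ioi (0 : ℝ),
          Real.log ((1 + Real.exp (-(2 * x))) / (1 - Real.exp (-(2 * x)))) * Real.cos (ω / a * x) := by
  set g : ℝ → ℝ := fun x => Real.log ((1 + Real.exp (-(2 * x))) / (1 - Real.exp (-(2 * x)))) *
    Real.cos (ω / a * x) with hg
  have hfun : (fun t => Real.log ((1 + Real.exp (-(2 * (a * t)))) / (1 - Real.exp (-(2 * (a * t))))) *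
      Real.cos (ω * t)) = fun t => g (a * t) := by
    funext t
    simp only [hg]
    congr 2
    field_simp
  rw [hfun]
  constructor
  · have h := (integrableOn_Ioi_comp_mul_left_iff g 0 ha).mpr
    rw [mul_zero] at h
    exact h (integrableOn_log_coth_mul_cos (ω / a))
  · rw [integral_comp_mul_left_Ioi g 0 ha, mul_zero, smul_eq_mul]

/-- **`f_β ∈ L¹(ℝ)`** (`β > 0`). [cite: CapelEtAl2023, §10.1.1 eq. (10.1)–(10.2)] -/
theorem integrable_qbpWeight {β : ℝ} (hβ : 0 < β) : Integrable (qbpWeight β) := by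
  have ha : 0 < π / (2 * β) := by positivity
  have h1 := (integral_log_coth_comp_mul_mul_cos ha 0).1
  simp only [zero_mul, Real.cos_zero, mul_one] at h1
  have h2 := (integrable_comp_abs_of_integrableOn h1).const_mul (2 / (β * π))
  refine h2.congr (Eventually.of_forall fun t => ?_)
  dsimp only
  rw [qbpWeight_eq_log_coth]

/-- `f_β · cos(ω ·)` and `f_β · sin(ω ·)` are integrable. [folklore] -/
private theorem integrable_qbpWeight_mul {β : ℝ} (hβ : 0 < β) {g : ℝ → ℝ} (hg : Continuous g)
    (hg1 : ∀ t, |g t| ≤ 1) : Integrable (fun t => qbpWeight β t * g t) :=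
  (integrable_qbpWeight hβ).mul_bdd hg.aestronglyMeasurable
    (ae_of_all _ fun t => by rw [Real.norm_eq_abs]; exact hg1 t)

/-- **The cosine transform of `f_β`**: for `β > 0` and `ω ≠ 0`,
`∫ f_β(t) cos(ωt) dt = 2 tanh(βω/2)/(βω)` (`= tanh(βω/2)/(βω/2) = f̂_β(ω)`, CMTW (10.1)).
[cite: CapelEtAl2023, §10.1.1 eq. (10.1)] -/
theorem integral_qbpWeight_mul_cos {β : ℝ} (hβ : 0 < β) {ω : ℝ} (hω : ω ≠ 0) :
    ∫ t, qbpWeight β t * Real.cos (ω * t) = 2 * Real.tanh (β * ω / 2) / (β * ω) := by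
  have ha : 0 < π / (2 * β) := by positivity
  have hπ : (π : ℝ) ≠ 0 := Real.pi_ne_zero
  -- the integrand is a function of `|t|`
  set F : ℝ → ℝ := fun s => 2 / (β * π) * (Real.log ((1 + Real.exp (-(2 * (π / (2 * β) * s)))) /
    (1 - Real.exp (-(2 * (π / (2 * β) * s))))) * Real.cos (ω * s)) with hF
  have hfun : (fun t => qbpWeight β t * Real.cos (ω * t)) = fun t => F |t| := by
    funext t
    have hcos : Real.cos (ω * t) = Real.cos (ω * |t|) := by
      rcases le_or_gt 0 t with h | h
      · rw [abs_of_nonneg h]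
      · rw [abs_of_neg h, mul_neg, Real.cos_neg]
    rw [qbpWeight_eq_log_coth, hcos, hF]
    dsimp only
    ring
  rw [hfun, integral_comp_abs (f := F), hF]
  dsimp only
  rw [integral_const_mul, (integral_log_coth_comp_mul_mul_cos ha ω).2]
  have hb : ω / (π / (2 * β)) ≠ 0 := div_ne_zero hω ha.ne'
  rw [integral_log_coth_mul_cos hb]
  have harg : π * (ω / (π / (2 * β))) / 4 = β * ω / 2 := by
    field_simp
    norm_num
  rw [harg]
  field_simp

/-- **`∫ f_β = 1`** (`β > 0`). [cite: CapelEtAl2023, §10.1.1 eq. (10.1)–(10.2)] -/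
theorem integral_qbpWeight {β : ℝ} (hβ : 0 < β) : ∫ t, qbpWeight β t = 1 := by
  have ha : 0 < π / (2 * β) := by positivity
  have hπ : (π : ℝ) ≠ 0 := Real.pi_ne_zero
  set F : ℝ → ℝ := fun s => 2 / (β * π) * (Real.log ((1 + Real.exp (-(2 * (π / (2 * β) * s)))) /
    (1 - Real.exp (-(2 * (π / (2 * β) * s))))) * Real.cos (0 * s)) with hF
  have hfun : (fun t => qbpWeight β t) = fun t => F |t| := by
    funext t
    rw [qbpWeight_eq_log_coth, hF]
    dsimp only
    rw [zero_mul, Real.cos_zero, mul_one]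
  rw [hfun, integral_comp_abs (f := F), hF]
  dsimp only
  rw [integral_const_mul, (integral_log_coth_comp_mul_mul_cos ha 0).2]
  simp only [zero_div, zero_mul, Real.cos_zero, mul_one]
  rw [integral_log_coth]
  field_simp
  ring

/-- **`‖f_β‖_{L¹} = 1`** (`β > 0`): `∫ |f_β| = 1`. [cite: CapelEtAl2023, §10.1.1 eq. (10.1)–(10.2)] -/
theorem integral_abs_qbpWeight {β : ℝ} (hβ : 0 < β) : ∫ t, |qbpWeight β t| = 1 := by
  rw [← integral_qbpWeight hβ]
  exact integral_congr_ae (Eventually.of_forall fun t => abs_of_nonneg (qbpWeight_nonneg hβ t))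

/-- The sine transform of the even function `f_β` vanishes (so `f̂_β` is the cosine transform, real and
even, CMTW (10.1)). [cite: CapelEtAl2023, §10.1.1 eq. (10.1)] -/
theorem integral_qbpWeight_mul_sin (β ω : ℝ) :
    ∫ t, qbpWeight β t * Real.sin (ω * t) = 0 := by
  have h := integral_neg_eq_self (fun t => qbpWeight β t * Real.sin (ω * t)) volume
  simp only [qbpWeight_neg, mul_neg, Real.sin_neg, integral_neg] at h
  linarith

/-- **The Fourier transform of `f_β`** in complex form: for `β > 0`, `ω ≠ 0`,
`∫ e^{itω} f_β(t) dt = 2 tanh(βω/2)/(βω)`. [cite: CapelEtAl2023, §10.1.1 eq. (10.1)] -/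
theorem integral_cexp_mul_qbpWeight {β : ℝ} (hβ : 0 < β) {ω : ℝ} (hω : ω ≠ 0) :
    ∫ t : ℝ, Complex.exp ((t : ℂ) * (ω : ℂ) * I) * (qbpWeight β t : ℂ) =
      ((2 * Real.tanh (β * ω / 2) / (β * ω) : ℝ) : ℂ) := by
  have hcos := integrable_qbpWeight_mul hβ (g := fun t => Real.cos (ω * t)) (by fun_prop)
    (fun t => Real.abs_cos_le_one _)
  have hsin := integrable_qbpWeight_mul hβ (g := fun t => Real.sin (ω * t)) (by fun_prop)
    (fun t => Real.abs_sin_le_one _)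
  have hfun : (fun t : ℝ => Complex.exp ((t : ℂ) * (ω : ℂ) * I) * (qbpWeight β t : ℂ)) =
      fun t => ((qbpWeight β t * Real.cos (ω * t) : ℝ) : ℂ) +
        I * ((qbpWeight β t * Real.sin (ω * t) : ℝ) : ℂ) := by
    funext t
    rw [← Complex.ofReal_mul, Complex.exp_mul_I, ← Complex.ofReal_cos, ← Complex.ofReal_sin]
    push_cast
    ring_nf
  have hcosC : Integrable (fun t : ℝ => ((qbpWeight β t * Real.cos (ω * t) : ℝ) : ℂ)) := hcos.ofReal
  have hsinC : Integrable (fun t : ℝ => I * ((qbpWeight β t * Real.sin (ω * t) : ℝ) : ℂ)) :=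
    hsin.ofReal.const_mul I
  rw [hfun, integral_add hcosC hsinC, integral_const_mul, integral_complex_ofReal,
    integral_complex_ofReal, integral_qbpWeight_mul_cos hβ hω, integral_qbpWeight_mul_sin β ω]
  simp

/-- The Fourier transform of `f_β` at `ω = 0` is `1`. [cite: CapelEtAl2023, §10.1.1 eq. (10.1)] -/
theorem integral_cexp_mul_qbpWeight_zero {β : ℝ} (hβ : 0 < β) :
    ∫ t : ℝ, Complex.exp ((t : ℂ) * (0 : ℂ) * I) * (qbpWeight β t : ℂ) = 1 := by
  simp only [mul_zero, zero_mul, Complex.exp_zero, one_mul]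
  rw [integral_complex_ofReal, integral_qbpWeight hβ]
  simp

/-! ## §3 The kernel identity (hypothesis `hfK` of `exists_qbp_conjugation`) -/

/-- `tanh(β(y-x)/2) · (e^{-βx} + e^{-βy}) = e^{-βx} - e^{-βy}`. [folklore] -/
private theorem tanh_mul_exp_add_exp (β x y : ℝ) :
    Real.tanh (β * (y - x) / 2) * (Real.exp (-(β * x)) + Real.exp (-(β * y))) =
      Real.exp (-(β * x)) - Real.exp (-(β * y)) := by
  rw [Real.tanh_eq_sinh_div_cosh, Real.sinh_eq, Real.cosh_eq]
  have hc : Real.exp (β * (y - x) / 2) + Real.exp (-(β * (y - x) / 2)) ≠ 0 := by positivity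
  -- write `e^{-βx} = e^{-m} e^{z}`, `e^{-βy} = e^{-m} e^{-z}` with `m = β(x+y)/2`, `z = β(y-x)/2`
  have hx : Real.exp (-(β * x)) = Real.exp (-(β * (x + y) / 2)) * Real.exp (β * (y - x) / 2) := by
    rw [← Real.exp_add]; ring_nf
  have hy : Real.exp (-(β * y)) = Real.exp (-(β * (x + y) / 2)) * Real.exp (-(β * (y - x) / 2)) := by
    rw [← Real.exp_add]; ring_nf
  rw [hx, hy]
  field_simp

/-- `K_β(x, x) = e^{-βx}`. [folklore] -/
private theorem duhamelKernel_self (β x : ℝ) : Matrix.duhamelKernel β x x = Real.exp (-(β * x)) := by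
  rw [Matrix.duhamelKernel]
  have h : ∀ s : ℝ, Real.exp (-(β * (s * x + (1 - s) * x))) = Real.exp (-(β * x)) := by
    intro s; ring_nf
  simp_rw [h]
  simp

/-- **THE KERNEL IDENTITY for `f_β`** (`β > 0`):
`f̂_β(y - x) · (e^{-βx} + e^{-βy}) = 2 K_β(x, y)`, with `f̂_β(ω) = ∫ e^{itω} f_β(t) dt` and the
logarithmic-mean kernel `K_β(x,y) = ∫₀¹ e^{-β(sy+(1-s)x)} ds = (e^{-βx} - e^{-βy})/(β(y-x))`
(`Matrix.duhamelKernel`).  This is exactly hypothesis `hfK` of `exists_qbp_conjugation`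
(`Theorems/TcThermcert1QbpGibbsDerivative`): with it, the QBP equation
`d/ds e^{-βH(s)} = -(β/2){e^{-βH(s)}, Φ_β^{H(s)}(V)}` holds for THE weight `f_β`
(CMTW Prop. 6 (a), §10.1.1: "`f̂_β(ω) = tanh(βω/2)/(βω/2)` iff the two derivative formulas agree").
[cite: CapelEtAl2023, Proposition 6 (a), §10.1.1 eq. (10.1)] -/
theorem qbpWeight_kernel_identity {β : ℝ} (hβ : 0 < β) (x y : ℝ) :
    (∫ t : ℝ, Complex.exp ((t : ℂ) * ((y : ℂ) - (x : ℂ)) * I) * (qbpWeight β t : ℂ)) *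
      (((Real.exp (-(β * x)) + Real.exp (-(β * y)) : ℝ)) : ℂ) =
        2 * (Matrix.duhamelKernel β x y : ℂ) := by
  rcases eq_or_ne y x with rfl | hne
  · -- `ω = 0`: `f̂(0) = 1`, `K(x,x) = e^{-βx}`
    have h0 := integral_cexp_mul_qbpWeight_zero hβ
    rw [sub_self, h0, duhamelKernel_self]
    push_cast
    ring
  · have hω : y - x ≠ 0 := sub_ne_zero.mpr hne
    have h := integral_cexp_mul_qbpWeight hβ hω
    rw [← Complex.ofReal_sub, h]
    -- real identity: `(2 tanh(βω/2)/(βω)) (e^{-βx}+e^{-βy}) = 2K`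
    have hK := Matrix.exp_sub_exp_eq_mul_duhamelKernel β x y
    have ht := tanh_mul_exp_add_exp β x y
    have hreal : 2 * Real.tanh (β * (y - x) / 2) / (β * (y - x)) *
        (Real.exp (-(β * x)) + Real.exp (-(β * y))) = 2 * Matrix.duhamelKernel β x y := by
      have hβ0 : β ≠ 0 := hβ.ne'
      rw [div_mul_eq_mul_div, mul_assoc, ht, hK]
      field_simp
    exact_mod_cast congrArg (fun r : ℝ => (r : ℂ)) hreal

/-! ## §4 The Matsubara-series form of `f_β` (bridge to `Theorems/TcThermcert1QbpWeight`) -/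

/-- **Series form**: for `β > 0` and `t ≠ 0`,
`f_β(t) = Σ_{m ≥ 0} (4/(β(2m+1)π)) e^{-(2m+1)π|t|/β}` (the expansion `log coth x = Σ (2/(2k+1)) e^{-2(2k+1)x}`
at `x = π|t|/(2β)`); this is the Matsubara-series presentation of the SAME weight used as hypothesis
`hf` in `Summits/Ventures/CertifiedManyBodySolver/Theorems/TcThermcert1QbpWeight.lean`.
[cite: CapelEtAl2023, §10.1.1 eq. (10.1)] -/
theorem hasSum_qbpWeight {β : ℝ} (hβ : 0 < β) {t : ℝ} (ht : t ≠ 0) :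
    HasSum (fun m : ℕ => 4 / (β * ((2 * (m : ℝ) + 1) * π)) *
      Real.exp (-((2 * (m : ℝ) + 1) * π / β * |t|))) (qbpWeight β t) := by
  have hx : 0 < π / (2 * β) * |t| := by positivity
  have h := (hasSum_log_coth hx).mul_left (2 / (β * π))
  rw [qbpWeight_eq_log_coth]
  have hπ : (π : ℝ) ≠ 0 := Real.pi_ne_zero
  have hβ0 : β ≠ 0 := hβ.ne'
  have hfun : (fun m : ℕ => 4 / (β * ((2 * (m : ℝ) + 1) * π)) *
      Real.exp (-((2 * (m : ℝ) + 1) * π / β * |t|))) = fun m : ℕ => 2 / (β * π) *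
        (2 / (2 * (m : ℝ) + 1) * Real.exp (-(2 * (2 * (m : ℝ) + 1) * (π / (2 * β) * |t|)))) := by
    funext m
    have hm : (2 * (m : ℝ) + 1) ≠ 0 := by positivity
    have he : -((2 * (m : ℝ) + 1) * π / β * |t|) = -(2 * (2 * (m : ℝ) + 1) * (π / (2 * β) * |t|)) := by
      field_simp
    rw [he]
    field_simp
    norm_num
  rw [hfun]
  exact h

/-- The Matsubara series DIVERGES at `t = 0` (harmonic tail), so its `tsum` there is Lean's junk
value `0` — which is also `qbpWeight β 0` (`log (2/0) = log 0 = 0`). [folklore] -/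
private theorem not_summable_qbpWeight_series_zero {β : ℝ} (hβ : 0 < β) :
    ¬ Summable (fun m : ℕ => 4 / (β * ((2 * (m : ℝ) + 1) * π))) := by
  intro hs
  have h1 : Summable (fun m : ℕ => 1 / ((m : ℝ) + 1)) := by
    refine Summable.of_nonneg_of_le (fun m => by positivity) (fun m => ?_) (hs.mul_left (β * π / 2))
    have hm : (0 : ℝ) < 2 * (m : ℝ) + 1 := by positivity
    rw [div_le_iff₀ (by positivity : (0 : ℝ) < (m : ℝ) + 1)]
    have : β * π / 2 * (4 / (β * ((2 * (m : ℝ) + 1) * π))) = 2 / (2 * (m : ℝ) + 1) := by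
      field_simp
      ring
    rw [this, div_mul_eq_mul_div, le_div_iff₀ hm]
    linarith
  have h2 : Summable (fun n : ℕ => 1 / (n : ℝ)) := by
    refine (summable_nat_add_iff 1).mp ?_
    refine h1.congr fun m => ?_
    push_cast
    rfl
  exact Real.not_summable_one_div_natCast h2

/-- **`f_β` IS the Matsubara series, at every `t`**: for `β > 0`,
`qbpWeight β t = Σ' m, (4/(β(2m+1)π)) e^{-(2m+1)π|t|/β}` (at `t = 0` both sides are the junk value `0`).
Hence `f := qbpWeight β` discharges the hypothesis `hf` of every theorem of
`Theorems/TcThermcert1QbpWeight.lean`, and the two presentations of CMTW (10.1) are interchangeable.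
[cite: CapelEtAl2023, §10.1.1 eq. (10.1)] -/
theorem qbpWeight_eq_tsum {β : ℝ} (hβ : 0 < β) (t : ℝ) :
    qbpWeight β t = ∑' m : ℕ, 4 / (β * ((2 * (m : ℝ) + 1) * π)) *
      Real.exp (-((2 * (m : ℝ) + 1) * π / β * |t|)) := by
  rcases eq_or_ne t 0 with rfl | ht
  · have hL : qbpWeight β 0 = 0 := by simp [qbpWeight]
    simp only [hL, abs_zero, mul_zero, neg_zero, Real.exp_zero, mul_one]
    exact (tsum_eq_zero_of_not_summable (not_summable_qbpWeight_series_zero hβ)).symm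
  · exact ((hasSum_qbpWeight hβ ht).tsum_eq).symm

end Literature.MathematicalPhysics.QuantumLattice
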